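import Literature.MathematicalPhysics.QuantumFieldTheory.Balaban1983to89.Node00.Record12

/-!
# NODE 00 (YM-PLAN Track A) — STAGE 12, FILE 12c: THE RESIDUAL DATA OF RECORD of `Stage12Params` and their displayed laws —
# the fluctuation factor `ζ_{k+1}(R, S)` of (3.16)·(3.20) [III] as PRINT's decomposition of unity at the one-cube backgrounds, the residual
# part `Zt` of the 𝐓-weights, the residual §2 data `Rz`; `zetaUnity`, `zetaAbs`, `ztLaws`, `ztLocal`, `ZtUnity`, `rzLaws` PROVED at them

Cell `pub-ymgap`, NODE 00, K0′-components seat `pub-ymgap-node00-def-K0b` (g0), rows P4 · P5 · P8 · P9 of the dag-lead's § K0′ table (NODE-TABLE v24,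
director-ym LINE №92 (3) ∕ №93).  [III] = [Balaban1988Convergent] (CMP **119** (1988) 243–285, journal page = PDF page + 242), [I] = [Balaban1987RG1].
Written against def-T's FILE 12b `Node00.Record12` v2.2 (`Stage12Params`: Stage-9 part with the residual `ζ : ZetaOfRecord`, `Rz : (K : ℕ) →
Sect2.Residual (Fam.P K) (MatA N)`, `Zt : (K : ℕ) → TkResidualW Fam N (FluctV N) K`; provisos `Provisos₁₂ = {base : Provisos₁₀, rzLaws, ztLaws, ztLocal, bg}`
with `base.zetaUnity : IsZetaUnity … θ.ζ`, `base.zetaAbs : IsZetaAbsLeOne … θ.ζ`; the named predicate `Stage12Params.ZtUnity`).  The assembler (K0a's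
`Node00.Record12Numerics`): `theta12OfRecord F N ζ Rz Zt` with `ν := numerics7OfRecord₁₂`, `τ9.M = 1`, `A₁ = 1`; the K0′ parameter is
`theta12OfRecord F 2 (zeta316OfRecord F 2 numerics7OfRecord₁₂ 1 1) (RzOfRecord F 2) (ZtOfRecord F 2)`.

WHAT THIS FILE IS.  The served crux K0′ (`Record12Inhabited := ∃ D w, IsRecordOfRecord₁₂C F 2 D w`) is closed field by field at ONE `θ : Stage12Params`;
three of its fields are RESIDUAL DATA (`ζ`, `Rz`, `Zt`) and five of its provisos (and one named predicate) are laws of that data.  This file supplies the data OF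
RECORD and proves those laws at it, so that the assembler of `θ` sets `ζ := zeta316OfRecord F N ν M A₁`, `Rz := RzOfRecord F N`, `Zt := ZtOfRecord F N`
(`HasResidualsOfRecord θ` by `⟨rfl, rfl, rfl⟩`) and cites `Stage12Params.HasResidualsOfRecord.zetaUnity ∕ .zetaAbs ∕ .rzLaws ∕ .ztLaws ∕ .ztLocal ∕ .ztUnity` (§4).
* §1 **`zeta316OfRecord`** — the residual `ζ_{k+1}(R_{k+1}, S_{k+1})` of n02-b's `ωOfRecord` (`Node00.StepWeightsOfRecord` §5) PINNED to print's (3.16)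
  p. 268: *«On this domain* [`Ω^{∼−1}_{k+1}`] *introduce the decomposition of unity 1 = Σ_{R_{k+1}} χ^{(k)}(Rᶜ_{k+1}) χ^{(k)c}(R_{k+1}), (3.16) where the summation
  is over the subdomains of Ω^{∼−1}_{k+1}, which are unions of L²M₂R_{k+1}-cubes»* — r11's `B14.Eq316.chiK`∕`chiKc` BY NAME over the (3.16) range of record
  (n02-b's `rcubes`, read at `(P_{k+1}, Q_{k+1})`: `cubes316`, `rcubes_eq_cubes316`), print's bond sets `(□′^{∼2})^{(k)*}` (n02-b's `sect3DataOfRecord….bondsStar`)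
  and print's threshold `δ_k = g_k A₁∕(A₀p₀(g_k))` ((3.4), n02-b's `deltaOfRecord`); the label `S_{k+1}` is PINNED TO `R_{k+1}` ((3.20) p. 269: `S_{k+1}`'s
  χ_{k+1}-cubes are `R_{k+1}`'s — FILE 12a `Node00.TkWeightsOfRecord` §4; n02-b's index map `σOfRecord` does not read `S`), so a label with `S ≠ R` weighs `0`.
  PROVED: `Σ_{(R,S)} ζ = 1` (**`isZetaUnity_zeta316OfRecord`**, = r11's `eq316`), `Σ_{(R,S)} |ζ| ≤ 1` (**`isZetaAbsLeOne_zeta316OfRecord`**), `0 ≤ ζ ≤ 1`,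
  and THE ONE NON-ZERO LABEL (`zeta316OfRecord_eq_one_iff`: `R_{k+1}` = the large-fluctuation χ_{k+1}-cubes of `Ω^{∼−1}_{k+1}`, r11's `eq316_term_eq_one_iff`);
  n02-b's (O2)∕(O3) at this `ζ` (`isStepUnity_wOfRecord_zeta316`, `abs_wOfRecord_zeta316_le_one`), and its joint measurability in `(V′, U)` FROM the measurability
  of r11's (3.3)-events at `δ_k` (`measurable_zeta316OfRecord`; the (O4) clause, displayed).  UNLIKE the Kronecker witness `Record9InhabitedSU1.zetaDeltaOfRecord` this
  `ζ` READS THE FIELDS through print's small∕large fluctuation dichotomy.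
* §2 **`ZtOfRecord`** — 12a's residual `TkResidualW = {ζ0, quad}`: `ζ0 := zeta0UnifOfRecord` (the UNIFORM partition of unity `1 ∕ #{Y}` over the region
  label, positive and constant), `quad := quadUnitOfRecord` (the unit covariance `Σ_{b ⊂ Λ′} ‖A_j(b)‖²`); **`ztLaws_ZtOfRecord`** (`ζ0 ≥ 0`), **`ztLocalLaws_ZtOfRecord`**
  (12b's locality law `LocalLaws`), **`finsum_ζ0_ZtOfRecord`** (12b's named partition of unity `ZtUnity`, a conjunct of the served K0′ text); the generic
  `ZtOfRecordQ q` (any `quad`) for the successor who types [I]'s form.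
* §3 **`RzOfRecord`** — 11b's residual `Sect2.Residual` at the UNIT recipe `Sect2.Residual.unit` (`U_n(M˙(·)) ≡ 1`, `J_n ≡ 0`, `U_{p,X} ≡ 1`, `𝐉_{p,X} ≡ 0`,
  `φ_j ≡ 1`); **`rzLaws_RzOfRecord`** (11c's `Sect2.Residual.Laws`, four `rfl`s — the inhabitant lemma def-T's K0′ table asked for).
* §4 `Stage12Params.HasResidualsOfRecord θ` (`θ.ζ`, `θ.Rz`, `θ.Zt` ARE the data of §§1–3) and, AT such `θ`, the proviso fields `zetaUnity`, `zetaAbs`, `rzLaws`,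
  `ztLaws`, `ztLocal` and the named predicate `ZtUnity`.

LOCATED (said, not claimed; each names a CONSTRUCTION THE TREE LACKS — the director's «residuals OF PRINT» is met to exactly this extent):
(iii) (3.16)'s fluctuation field is `A_k = (1∕i) log[V_k (V^{(k)})⁻¹]` with the GLOBAL minimiser `V^{(k)} = M^k(U_{k+1})` of (3.10) p. 266 — in the tree a `Prop`
    WITHOUT BODY (r11's `B14.Sect3Decomp.Claim310`); `zeta316OfRecord` reads instead the ONE-CUBE backgrounds `V^{(k)}_{□′} = M^k(U_{k+1,□′})` of (3.4) (r11's `Vbox`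
    on n02-b's `sect3DataOfRecord`), cube by cube.  Print, (3.13) p. 267: `|V^{(k)} − V^{(k)}_{□′}| ≤ (4dL)²(1+β₀)B₃ε_k = O(1)ε_k` on `□′^∼` (≪ `δ_k`).
(iv) `|A_k(b)|` is read as `|V_k(b) V^{(k)}_{□′}(b)⁻¹ − 1|` (`dist1`, print's own (3.3) form; `|e^{iA} − 1|` and `|A|` agree to second order) — no matrix logarithm.
(v)  the change of variables (3.22)∕(1.22) of p. 269 is NOT applied (= 12a's located deviation (ii)).
    CONSEQUENCE of (iii)+(iv): on one cube, (3.16)-small at `δ_k` ⇒ (3.3)-small at `2δ_k` is IMMEDIATE here (`smallFluct_bonds316_iff`), whereas print derives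
    «χ′ = 1 on Rᶜ» from (3.17)–(3.19): NO consumer may read (3.17)–(3.19) content into this `ζ` (ref-H READ-13 WATCH species).
(vi) `ζ0` OF PRINT (the resummation over `(P_{k+1}, Q_{k+1})` of p. 267, for FIXED `Ω_{k+1} = Yᶜ`) is NOT EXPRESSIBLE in 11a's `(j, Y, ω)`-indexed signature (12a §3,
    located there: it reads the old sequence through the (3.2)∕(3.3) windows); `zeta0UnifOfRecord` is the UNIFORM partition of unity over `Y` — it meets the three
    typed constraints (`Laws`, `LocalLaws`, `ZtUnity`) and reads no field.
(vii) `quad` OF PRINT is [I]'s `⟨A_j, 𝒬_j(Λ′)A_j⟩` ((1.5)∕(2.11) [I], (1.26)∕(3.23) [III]) — it needs the Sect. D [13] operators AS FUNCTIONS OF THE BACKGROUND, «NOT TYPED»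
    (`B12Eq15QuadraticForm` header); `quadUnitOfRecord` is a UNIT-COVARIANCE PLACEHOLDER, chosen non-degenerate so that 11a's A-factors (`Tk.aOp`: Lebesgue on the
    fluctuation variables after the weight `χ·exp(−½ quad)`) stay Gaussian integrals (at `quad := 0` the Bochner convention sends non-integrable operands to `0`).
(viii) `Rz` OF PRINT — `𝐔 ↦ U_n(M˙(𝐔)), J_n(M˙(𝐔))` of [I] (1.15) and `U_{p,X}, 𝐉_{p,X}` of (2.35) — are the ANALYTIC CONTINUATIONS of [14]∕[15]: «no tree object; a
    `Classical.epsilon` recipe would be junk-laden» (11b `Node00.Sect2FrameOfRecord` header).  JUNK DIRECTION of the unit recipe (11b's analysis): it makes (iv) (1.16)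
    and (2.34)–(2.37) VACUOUS, i.e. it ENLARGES `U^c_j`∕`Ũ^c_j` of record — `bg` becomes EASIER than print's statement, every §2-form law (analyticity and bounds ON
    the space) STRONGER than print's theorem.
    ⇒ At a `θ` with `HasResidualsOfRecord θ` the 𝐓-step law `SLaw₁₂ k → TLaw₁₂ k` and the (2.18) identity are NOT print's statements; print's residuals need three
    constructions: (C1) a body for (3.10)'s minimiser, (C2) [13] Sect. D's operators as functions of the background, (C3) [14]∕[15]'s analytic backgrounds.  The
    placeholders are isolated so that successors swap BODIES without touching consumers: `fluctSize316` (C1), `ZtOfRecordQ q` (C2), `RzOfRecord` (C3).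

HONEST SCOPE.  Definitions of record + `{0,1}`-bookkeeping (`Finset.prod_add` via r11's `eq316`, `Finset.sum_filter`, `rfl`).  NOTHING of Bałaban's is
asserted: not Theorem 2 [III], not (3.6)–(3.19), not [13]–[16]; no positivity of `A₁`, `δ_k` assumed.  Counts unmoved (typed 28∕28 · discharged 5∕28); nothing
here is a discharge; one finite torus at fixed `ε = L^{−K}` — not continuum ∕ ℝ⁴ ∕ OS ∕ mass-gap ∕ Clay.  No `sorry`, no `axiom`, no `instance`, no `notation`.
-/

noncomputable section

open MeasureTheory
open scoped BigOperators Matrix.Norms.L2Operator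

namespace Literature.MathematicalPhysics.QuantumFieldTheory.Balaban1983to89.Node00

open T4NestedCovariance T4AdjointCovariance T4AveragingDisintegration T4Continuum T4FiniteEpsInhabited
open B15DeterminingSets B14.Eq213DetSet B14.Eq216Concrete B14.Eq213MaximalDomains B15Eq112TorusCover B14DomainGeom
open B14.Sect3Decomp B14.Eq316 B14.Eq218Concrete
open Tk

/-! ## §1  The fluctuation factor `ζ_{k+1}(R, S)` OF RECORD: (3.16) at the one-cube backgrounds, `S` pinned to `R` -/

section Zeta316

variable (F : T4Family) (N : ℕ) [NeZero N] (ν : Stage7Numerics) (M : ℕ) (p : B12.RunParams) (g : ℕ → ℝ) (k : ℕ)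

/-- **THE (3.16) SUMMATION RANGE read at `(P_{k+1}, Q_{k+1})`**: the χ_{k+1}-cubes inside `Ω^{∼−1}_{k+1}` («the domain obtained by taking off one layer of
LMR_{k+1}-cubes from Ω_{k+1}»), `Ω_{k+1} = Ω_{k+1}(P, Q)` of (3.5) of record (n02-b's `OmegaOfLabel`, which reads the label only through `P`, `Q`).
[cite: Balaban1988Convergent, (3.16) p.268, (3.5) p.265] -/
def cubes316 (s : SeqOfRecord F ν M g p.K k) (Pl Ql : Finset (Iχ F ν p g k)) : Finset (Iχ F ν p g k) :=
  cubesIn (cubeχ F ν p g k)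
    (innerD (F.P p.K) (sideD F ν M p g k) 1
      (fillD (F.P p.K) (sideD F ν M p g k) (Omega0 F ν M p g k s Pl Ql ∩ guardΩ F ν M p g k s Pl)))

/-- n02-b's (3.16) range of the label `t = (P, Q, R, S)` IS `cubes316` at `(P, Q)` (`rfl`: the index map does not read `(R, S)` there).
[cite: Balaban1988Convergent, (3.16) p.268 (bookkeeping)] -/
theorem rcubes_eq_cubes316 (s : SeqOfRecord F ν M g p.K k) (t : LbOfRecord F ν p g k) :
    rcubes F ν M p g k s t = cubes316 F ν M p g k s t.1 t.2.1 := rfl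

open Classical in
/-- **THE BOND SETS OF (3.16)**, tagged by their cube: `□′ ↦ {□′} × (□′^{∼2})^{(k)*}` (the bond set is n02-b's pinned `bondsStar`, verbatim r11∕12a); the tag lets
the fluctuation field be read against the background OF THAT CUBE (located deviation (iii)). [cite: Balaban1988Convergent, (3.16) p.268, (3.3) p.265] -/
def bonds316 (s : SeqOfRecord F ν M g p.K k) (c : Iχ F ν p g k) : Finset (Iχ F ν p g k × PBond (F.P p.K) k) :=
  ((sect3DataOfRecord F N ν M p g k s).bondsStar c).image (Prod.mk c)

/-- **THE SIZE OF THE FLUCTUATION FIELD OF RECORD** on the bond `b` against the background of the cube `□′`: `|V_k(b) (V^{(k)}_{□′}(b))⁻¹ − 1|` with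
`V^{(k)}_{□′} = M^k(U_{k+1,□′})` of (3.4) (r11's `Vbox` on n02-b's pinned data) — print's `|A_k(b)|`, `A_k = (1∕i) log[V_k (V^{(k)})⁻¹]`, at the one-cube
background and in the `|· − 1|` form (located deviations (iii), (iv)). [cite: Balaban1988Convergent, (3.16) p.268, (3.4) p.265, (3.10)–(3.11) p.266] -/
def fluctSize316 (s : SeqOfRecord F ν M g p.K k) (U : GaugeField (F.P p.K) k (SU N)) (V' : GaugeField (F.P p.K) (k + 1) (SU N)) :
    Iχ F ν p g k × PBond (F.P p.K) k → ℝ :=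
  fun cb => dist1 (U cb.2 * (Vbox (sect3DataOfRecord F N ν M p g k s) (avOfRecord F N p.K) cb.1 V' cb.2)⁻¹)

variable {F N ν M p g k} in
/-- The fluctuation size is nonnegative (`dist1 ≥ 0`). [cite: Balaban1988Convergent, (3.16) p.268 (bookkeeping)] -/
theorem fluctSize316_nonneg (s : SeqOfRecord F ν M g p.K k) (U : GaugeField (F.P p.K) k (SU N)) (V' : GaugeField (F.P p.K) (k + 1) (SU N))
    (cb : Iχ F ν p g k × PBond (F.P p.K) k) : 0 ≤ fluctSize316 F N ν M p g k s U V' cb :=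
  GaugeGroup.dist1_nonneg _

variable {F N ν M p g k} in
/-- **DICTIONARY**: the small-fluctuation condition of (3.16) of record on the cube `□′` at threshold `δ` IS r11's small approximate-fluctuation condition of (3.3)
on the pinned data at the same threshold — the consequence of the located deviations (iii)+(iv) every consumer must know. [cite: Balaban1988Convergent, (3.16) p.268, (3.3) p.265] -/
theorem smallFluct_bonds316_iff (s : SeqOfRecord F ν M g p.K k) (U : GaugeField (F.P p.K) k (SU N)) (V' : GaugeField (F.P p.K) (k + 1) (SU N)) (δ : ℝ)
    (c : Iχ F ν p g k) :
    SmallFluct (bonds316 F N ν M p g k s) (fluctSize316 F N ν M p g k s U V') δ c ↔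
      SmallApproxFluct (sect3DataOfRecord F N ν M p g k s) (avOfRecord F N p.K) δ U V' c := by
  classical
  unfold SmallFluct SmallApproxFluct bonds316
  simp only [Finset.mem_image, forall_exists_index, and_imp]
  constructor
  · intro h b hb
    have h' := h (c, b) b hb rfl
    rwa [Real.norm_eq_abs, abs_of_nonneg (fluctSize316_nonneg s U V' _)] at h'
  · rintro h cb b hb rfl
    rw [Real.norm_eq_abs, abs_of_nonneg (fluctSize316_nonneg s U V' _)]
    exact h b hb

open Classical in
/-- **THE FLUCTUATION FACTOR OF RECORD `ζ_{k+1}(R_{k+1}, S_{k+1})`** — print's (3.16) term `χ^{(k)}(Rᶜ_{k+1}) χ^{(k)c}(R_{k+1})` (r11's `chiK`∕`chiKc`: the products over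
the cubes of `{sup_{b ∈ (□′^{∼2})^{(k)*}} |A_k(b)| < δ_k}` resp. `{… ≥ δ_k}`) for `R_{k+1} ⊆` the (3.16) range, `Rᶜ_{k+1}` «the complement of R_{k+1} to the domain
Ω^{∼−1}_{k+1}», at print's `δ_k = g_k A₁∕(A₀p₀(g_k))` ((3.4), n02-b's `deltaOfRecord`) and the fluctuation sizes of record; the label `S_{k+1}` PINNED to `R_{k+1}`
((3.20): as a family of χ_{k+1}-cubes `S_{k+1}` is `R_{k+1}`); every other label weighs `0`. [cite: Balaban1988Convergent, (3.16) p.268, (3.20)–(3.21) p.269, (3.4) p.265] -/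
def zeta316OfRecord (A₁ : ℝ) : ZetaOfRecord F N ν M :=
  fun p g k s Pl Ql RS U V' =>
    if RS.1 ⊆ cubes316 F ν M p g k s Pl Ql ∧ RS.2 = RS.1 then
      chiK (bonds316 F N ν M p g k s) (fluctSize316 F N ν M p g k s U V') (deltaOfRecord ν g k A₁) (cubes316 F ν M p g k s Pl Ql \ RS.1) *
        chiKc (bonds316 F N ν M p g k s) (fluctSize316 F N ν M p g k s U V') (deltaOfRecord ν g k A₁) RS.1
    else 0

/-! ### `{0,1}`-bookkeeping of r11's (3.16) factors -/

section ChiK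

variable {ι β 𝔸 : Type*} [SeminormedAddCommGroup 𝔸] (bonds : ι → Finset β) (A : β → 𝔸) (δ : ℝ)

/-- `0 ≤ χ^{(k)}(X)` (a product of `0∕1` factors). [cite: Balaban1988Convergent, (3.16) p.268 (bookkeeping)] -/
theorem chiK_nonneg' (X : Finset ι) : 0 ≤ chiK bonds A δ X := by
  unfold chiK
  exact Finset.prod_nonneg fun c _ => by split_ifs <;> norm_num

/-- `χ^{(k)}(X) ≤ 1`. [cite: Balaban1988Convergent, (3.16) p.268 (bookkeeping)] -/
theorem chiK_le_one' (X : Finset ι) : chiK bonds A δ X ≤ 1 := by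
  unfold chiK
  exact Finset.prod_le_one (fun c _ => by split_ifs <;> norm_num) fun c _ => by split_ifs <;> norm_num

/-- `0 ≤ χ^{(k)c}(X)`. [cite: Balaban1988Convergent, (3.16) p.268 (bookkeeping)] -/
theorem chiKc_nonneg' (X : Finset ι) : 0 ≤ chiKc bonds A δ X := by
  unfold chiKc
  exact Finset.prod_nonneg fun c _ => by split_ifs <;> norm_num

/-- `χ^{(k)c}(X) ≤ 1`. [cite: Balaban1988Convergent, (3.16) p.268 (bookkeeping)] -/
theorem chiKc_le_one' (X : Finset ι) : chiKc bonds A δ X ≤ 1 := by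
  unfold chiKc
  exact Finset.prod_le_one (fun c _ => by split_ifs <;> norm_num) fun c _ => by split_ifs <;> norm_num

/-- A sum over all finite subsets with the indicator of `· ⊆ C` is the sum over the powerset of `C`. [folklore] -/
private theorem sum_ite_subset_eq_sum_powerset' [Fintype ι] [DecidableEq ι] (C : Finset ι) (f : Finset ι → ℝ) :
    (∑ X : Finset ι, if X ⊆ C then f X else 0) = ∑ X ∈ C.powerset, f X := by
  rw [← Finset.sum_filter]
  refine Finset.sum_congr ?_ (fun _ _ => rfl)
  ext X
  simp

end ChiK

variable {F N ν M} (A₁ : ℝ) {p g k}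

/-- Unfolding ON the pinned labels: for `R ⊆` the (3.16) range and `S = R` the factor is print's (3.16) term. [cite: Balaban1988Convergent, (3.16) p.268 (bookkeeping)] -/
theorem zeta316OfRecord_apply_of_subset (s : SeqOfRecord F ν M g p.K k) (Pl Ql R : Finset (Iχ F ν p g k)) (hR : R ⊆ cubes316 F ν M p g k s Pl Ql)
    (U : GaugeField (F.P p.K) k (SU N)) (V' : GaugeField (F.P p.K) (k + 1) (SU N)) :
    zeta316OfRecord F N ν M A₁ p g k s Pl Ql (R, R) U V' =
      chiK (bonds316 F N ν M p g k s) (fluctSize316 F N ν M p g k s U V') (deltaOfRecord ν g k A₁) (cubes316 F ν M p g k s Pl Ql \ R) *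
        chiKc (bonds316 F N ν M p g k s) (fluctSize316 F N ν M p g k s U V') (deltaOfRecord ν g k A₁) R := by
  unfold zeta316OfRecord
  rw [if_pos ⟨hR, rfl⟩]

/-- OFF the pinned labels (`R` not inside the (3.16) range, or `S ≠ R`) the factor is `0`. [cite: Balaban1988Convergent, (3.16) p.268, (3.20) p.269 (bookkeeping)] -/
theorem zeta316OfRecord_eq_zero_of_not (s : SeqOfRecord F ν M g p.K k) (Pl Ql : Finset (Iχ F ν p g k))
    (RS : Finset (Iχ F ν p g k) × Finset (Iχ F ν p g k)) (h : ¬ (RS.1 ⊆ cubes316 F ν M p g k s Pl Ql ∧ RS.2 = RS.1))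
    (U : GaugeField (F.P p.K) k (SU N)) (V' : GaugeField (F.P p.K) (k + 1) (SU N)) :
    zeta316OfRecord F N ν M A₁ p g k s Pl Ql RS U V' = 0 := by
  unfold zeta316OfRecord
  rw [if_neg h]

/-- `0 ≤ ζ_{k+1}(R, S)` of record. [cite: Balaban1988Convergent, (3.16) p.268 (bookkeeping)] -/
theorem zeta316OfRecord_nonneg (p : B12.RunParams) (g : ℕ → ℝ) (k : ℕ) (s : SeqOfRecord F ν M g p.K k) (Pl Ql : Finset (Iχ F ν p g k))
    (RS : Finset (Iχ F ν p g k) × Finset (Iχ F ν p g k)) (U : GaugeField (F.P p.K) k (SU N)) (V' : GaugeField (F.P p.K) (k + 1) (SU N)) :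
    0 ≤ zeta316OfRecord F N ν M A₁ p g k s Pl Ql RS U V' := by
  unfold zeta316OfRecord
  split_ifs
  · exact mul_nonneg (chiK_nonneg' _ _ _ _) (chiKc_nonneg' _ _ _ _)
  · exact le_rfl

/-- `ζ_{k+1}(R, S) ≤ 1` of record. [cite: Balaban1988Convergent, (3.16) p.268 (bookkeeping)] -/
theorem zeta316OfRecord_le_one (p : B12.RunParams) (g : ℕ → ℝ) (k : ℕ) (s : SeqOfRecord F ν M g p.K k) (Pl Ql : Finset (Iχ F ν p g k))
    (RS : Finset (Iχ F ν p g k) × Finset (Iχ F ν p g k)) (U : GaugeField (F.P p.K) k (SU N)) (V' : GaugeField (F.P p.K) (k + 1) (SU N)) :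
    zeta316OfRecord F N ν M A₁ p g k s Pl Ql RS U V' ≤ 1 := by
  unfold zeta316OfRecord
  split_ifs
  · exact mul_le_one₀ (chiK_le_one' _ _ _ _) (chiKc_nonneg' _ _ _ _) (chiKc_le_one' _ _ _ _)
  · exact zero_le_one

/-- **(3.16) RESOLVES UNITY AT THE RECORD**: `Σ_{(R,S)} ζ_{k+1}(R, S) = Σ_{R ⊆ Ω^{∼−1}_{k+1}} χ^{(k)}(Rᶜ) χ^{(k)c}(R) = 1` — r11's `eq316` BY NAME after the `S = R` pin
collapses the `S`-sum. [cite: Balaban1988Convergent, (3.16) p.268, (3.20)–(3.21) p.269] -/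
theorem sum_zeta316OfRecord (p : B12.RunParams) (g : ℕ → ℝ) (k : ℕ) (s : SeqOfRecord F ν M g p.K k) (Pl Ql : Finset (Iχ F ν p g k))
    (U : GaugeField (F.P p.K) k (SU N)) (V' : GaugeField (F.P p.K) (k + 1) (SU N)) :
    ∑ RS, zeta316OfRecord F N ν M A₁ p g k s Pl Ql RS U V' = 1 := by
  classical
  set C := cubes316 F ν M p g k s Pl Ql with hC
  set f : Finset (Iχ F ν p g k) → ℝ := fun R =>
    chiK (bonds316 F N ν M p g k s) (fluctSize316 F N ν M p g k s U V') (deltaOfRecord ν g k A₁) (C \ R) *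
      chiKc (bonds316 F N ν M p g k s) (fluctSize316 F N ν M p g k s U V') (deltaOfRecord ν g k A₁) R with hf
  have hterm : ∀ RS : Finset (Iχ F ν p g k) × Finset (Iχ F ν p g k),
      zeta316OfRecord F N ν M A₁ p g k s Pl Ql RS U V' = if RS.1 ⊆ C ∧ RS.2 = RS.1 then f RS.1 else 0 := fun RS => rfl
  simp_rw [hterm]
  rw [Fintype.sum_prod_type]
  have hinner : ∀ R : Finset (Iχ F ν p g k),
      (∑ S : Finset (Iχ F ν p g k), if R ⊆ C ∧ S = R then f R else 0) = if R ⊆ C then f R else 0 := by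
    intro R
    by_cases h : R ⊆ C
    · simp only [h, true_and, if_true]
      rw [Finset.sum_ite_eq' Finset.univ R (fun _ => f R)]
      simp
    · simp [h]
  simp_rw [hinner]
  rw [sum_ite_subset_eq_sum_powerset' C f]
  exact eq316 _ _ _ C

/-- **P4 · `zetaUnity`**: the displayed law `IsZetaUnity` HOLDS for the fluctuation factor of record (every run, history, step, sequence, `(P, Q)`, fields).
[cite: Balaban1988Convergent, (3.16) p.268, (3.20)–(3.21) p.269] -/
theorem isZetaUnity_zeta316OfRecord : IsZetaUnity F N ν M (zeta316OfRecord F N ν M A₁) :=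
  fun p g k s Pl Ql U V' => sum_zeta316OfRecord A₁ p g k s Pl Ql U V'

/-- **P5 · `zetaAbs`**: the displayed law `IsZetaAbsLeOne` HOLDS for the fluctuation factor of record (`ζ ≥ 0`, so `Σ |ζ| = Σ ζ = 1`).
[cite: Balaban1988Convergent, (3.16) p.268, (3.21) p.269] -/
theorem isZetaAbsLeOne_zeta316OfRecord : IsZetaAbsLeOne F N ν M (zeta316OfRecord F N ν M A₁) := by
  intro p g k s Pl Ql U V'
  have h : ∑ RS, |zeta316OfRecord F N ν M A₁ p g k s Pl Ql RS U V'| = ∑ RS, zeta316OfRecord F N ν M A₁ p g k s Pl Ql RS U V' :=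
    Finset.sum_congr rfl fun RS _ => abs_of_nonneg (zeta316OfRecord_nonneg A₁ p g k s Pl Ql RS U V')
  rw [h, sum_zeta316OfRecord A₁ p g k s Pl Ql U V']

/-- **THE ONE NON-ZERO LABEL** (print: «the summation … selects» the large-field region): `ζ_{k+1}(R, S) = 1` iff `S = R` and `R` is EXACTLY the family of
χ_{k+1}-cubes of `Ω^{∼−1}_{k+1}` carrying a bond with `|V_k(b)V^{(k)}_{□′}(b)⁻¹ − 1| ≥ δ_k` (r11's `eq316_term_eq_one_iff` at the record).
[cite: Balaban1988Convergent, (3.16) p.268, (3.20) p.269] -/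
theorem zeta316OfRecord_eq_one_iff (p : B12.RunParams) (g : ℕ → ℝ) (k : ℕ) (s : SeqOfRecord F ν M g p.K k) (Pl Ql : Finset (Iχ F ν p g k))
    (RS : Finset (Iχ F ν p g k) × Finset (Iχ F ν p g k)) (U : GaugeField (F.P p.K) k (SU N)) (V' : GaugeField (F.P p.K) (k + 1) (SU N)) :
    zeta316OfRecord F N ν M A₁ p g k s Pl Ql RS U V' = 1 ↔
      RS.2 = RS.1 ∧ RS.1 = (cubes316 F ν M p g k s Pl Ql).filter fun c =>
        ¬ SmallFluct (bonds316 F N ν M p g k s) (fluctSize316 F N ν M p g k s U V') (deltaOfRecord ν g k A₁) c := by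
  classical
  constructor
  · intro h
    by_cases hc : RS.1 ⊆ cubes316 F ν M p g k s Pl Ql ∧ RS.2 = RS.1
    · refine ⟨hc.2, ?_⟩
      have h1 := h
      unfold zeta316OfRecord at h1
      rw [if_pos hc] at h1
      exact (eq316_term_eq_one_iff _ _ _ _ RS.1 hc.1).mp h1
    · rw [zeta316OfRecord_eq_zero_of_not A₁ s Pl Ql RS hc U V'] at h
      exact absurd h zero_ne_one
  · rintro ⟨hS, hR⟩
    have hsub : RS.1 ⊆ cubes316 F ν M p g k s Pl Ql := by rw [hR]; exact Finset.filter_subset _ _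
    unfold zeta316OfRecord
    rw [if_pos ⟨hsub, hS⟩]
    exact (eq316_term_eq_one_iff _ _ _ _ RS.1 hsub).mpr hR

variable (F N ν M) in
/-- n02-b's (O2) at the fluctuation factor of record: the T-step weights `wOfRecord A₁ ζ` RESOLVE UNITY (FILE 1's `IsStepUnity`; `isStepUnity_wOfRecord`).
[cite: Balaban1988Convergent, (3.1)–(3.5) p.264–265, (3.16) p.268] -/
theorem isStepUnity_wOfRecord_zeta316 (p : B12.RunParams) (g : ℕ → ℝ) (k : ℕ) :
    IsStepUnity (avOfRecord F N p.K k).avg (chiSeqOfRecord F N ν M g p.K k) (chiSeqOfRecord F N ν M g p.K (k + 1))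
      (wOfRecord F N ν M A₁ (zeta316OfRecord F N ν M A₁) p g k) :=
  isStepUnity_wOfRecord F N ν M A₁ (isZetaUnity_zeta316OfRecord A₁) p g k

variable (F N ν M) in
/-- n02-b's (O3) at the fluctuation factor of record: `|w(s′)(U, V′)| ≤ 1` (the `absW_le` proviso; `abs_wOfRecord_le_one`). [cite: Balaban1988Convergent, (3.16) p.268, (3.21) p.269] -/
theorem abs_wOfRecord_zeta316_le_one (p : B12.RunParams) (g : ℕ → ℝ) (k : ℕ) (s' : SeqOfRecord F ν M g p.K (k + 1))
    (U : GaugeField (F.P p.K) k (SU N)) (V' : GaugeField (F.P p.K) (k + 1) (SU N)) :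
    |wOfRecord F N ν M A₁ (zeta316OfRecord F N ν M A₁) p g k s' U V'| ≤ 1 :=
  abs_wOfRecord_le_one F N ν M A₁ (isZetaAbsLeOne_zeta316OfRecord A₁) p g k s' U V'

/-- **JOINT MEASURABILITY OF `ζ_{k+1}(R, S)` IN `(V′, U)` FROM THE MEASURABILITY OF THE (3.16) EVENTS** — the face the (O4) proviso `measω` needs from THIS factor: the
factor of record is a finite product of indicators of r11's events `{(U, V′) : SmallApproxFluct … δ_k U V′ □′}` (`smallFluct_bonds316_iff`) — the SAME events n02-b's
`bWeight` reads (at `2δ_k`), built on def-R's (2.12) solution map; their measurability is DISPLAYED (K0c's clause), not asserted.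
[cite: Balaban1988Convergent, (3.16) p.268, (3.3) p.265, (3.24)–(3.25) p.270] -/
theorem measurable_zeta316OfRecord (p : B12.RunParams) (g : ℕ → ℝ) (k : ℕ) (s : SeqOfRecord F ν M g p.K k) (Pl Ql : Finset (Iχ F ν p g k))
    (RS : Finset (Iχ F ν p g k) × Finset (Iχ F ν p g k))
    (h : ∀ c : Iχ F ν p g k, MeasurableSet {z : GaugeField (F.P p.K) (k + 1) (SU N) × GaugeField (F.P p.K) k (SU N) |
      SmallApproxFluct (sect3DataOfRecord F N ν M p g k s) (avOfRecord F N p.K) (deltaOfRecord ν g k A₁) z.2 z.1 c}) :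
    Measurable (fun z : GaugeField (F.P p.K) (k + 1) (SU N) × GaugeField (F.P p.K) k (SU N) =>
      zeta316OfRecord F N ν M A₁ p g k s Pl Ql RS z.2 z.1) := by
  classical
  have hev : ∀ c : Iχ F ν p g k, MeasurableSet {z : GaugeField (F.P p.K) (k + 1) (SU N) × GaugeField (F.P p.K) k (SU N) |
      SmallFluct (bonds316 F N ν M p g k s) (fluctSize316 F N ν M p g k s z.2 z.1) (deltaOfRecord ν g k A₁) c} := by
    intro c
    have hset : {z : GaugeField (F.P p.K) (k + 1) (SU N) × GaugeField (F.P p.K) k (SU N) |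
        SmallFluct (bonds316 F N ν M p g k s) (fluctSize316 F N ν M p g k s z.2 z.1) (deltaOfRecord ν g k A₁) c} =
        {z | SmallApproxFluct (sect3DataOfRecord F N ν M p g k s) (avOfRecord F N p.K) (deltaOfRecord ν g k A₁) z.2 z.1 c} := by
      ext z
      exact smallFluct_bonds316_iff s z.2 z.1 _ c
    rw [hset]
    exact h c
  by_cases hc : RS.1 ⊆ cubes316 F ν M p g k s Pl Ql ∧ RS.2 = RS.1
  · simp only [zeta316OfRecord, if_pos hc]
    refine Measurable.mul ?_ ?_
    · unfold chiK
      exact Finset.measurable_prod _ fun c _ => Measurable.ite (hev c) measurable_const measurable_const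
    · unfold chiKc
      exact Finset.measurable_prod _ fun c _ => Measurable.ite (hev c) measurable_const measurable_const
  · simp only [zeta316OfRecord, if_neg hc]
    exact measurable_const

end Zeta316

/-! ## §2  The residual part `Zt` of the 𝐓-weights OF RECORD -/

section Zt

variable (F : T4Family) (N : ℕ)

open Classical in
/-- **UNIT-COVARIANCE PLACEHOLDER for `⟨A_j, 𝒬_j(Λ′) A_j⟩`**: `Σ ‖A_j(b)‖²` over the scale-`j` bonds with both ends in `Λ′` (`A_j = (ω j).2`).  NOT [I]'s form
(located (vii): the Sect. D [13] operators as functions of the background are not in the tree); non-degenerate, so that 11a's A-factors are Gaussian.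
[cite: Balaban1987RG1, (1.5) p.261, (2.11) p.267; Balaban1988Convergent, (2.21) p.258, (3.23) p.270 (the slot it fills)] -/
def quadUnitOfRecord (K : ℕ) (j : ℕ) (Λ' : Set (Site (F.P K) 0)) (ω : MultiCfg (F.P K) (SU N) (FluctV N)) : ℝ :=
  ∑ b ∈ Finset.univ.filter (fun b : PBond (F.P K) j => b.src ∈ pts j Λ' ∧ b.tgt ∈ pts j Λ'), ‖(ω j).2 b‖ ^ 2

variable {F N} in
/-- The placeholder form is nonnegative. [cite: Balaban1987RG1, (1.5) p.261 (bookkeeping)] -/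
theorem quadUnitOfRecord_nonneg (K : ℕ) (j : ℕ) (Λ' : Set (Site (F.P K) 0)) (ω : MultiCfg (F.P K) (SU N) (FluctV N)) :
    0 ≤ quadUnitOfRecord F N K j Λ' ω := by
  unfold quadUnitOfRecord
  exact Finset.sum_nonneg fun b _ => by positivity

/-- **THE UNIFORM RESIDUAL FACTOR `ζ0`**: the constant `1 ∕ #{Y ⊆ T_η}` — the uniform partition of unity over the region label `Y` (12b's named predicate
`Stage12Params.ZtUnity`: `Σ_Y ζ0 j Y ω = 1`), constant in `ω` (the locality law `LocalLaws` trivially), positive (12a's law `ζ0 ≥ 0`; NOWHERE zero — not the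
(S3) species `Zt = 0`).  NOT print's `ζ0` (located (vi): the `(P, Q)`-resummation of p. 267 is not expressible in the `(j, Y, ω)` signature).
[cite: Balaban1988Convergent, p.267, (3.16)–(3.20) pp.268–269 (the laws it meets)] -/
def zeta0UnifOfRecord (K : ℕ) : ℕ → Set (Site (F.P K) 0) → MultiCfg (F.P K) (SU N) (FluctV N) → ℝ :=
  fun _ _ _ => ((Nat.card (Set (Site (F.P K) 0)) : ℝ))⁻¹

variable {F N} in
/-- The uniform factor is nonnegative. [cite: Balaban1988Convergent, p.267 (bookkeeping)] -/
theorem zeta0UnifOfRecord_nonneg (K : ℕ) (j : ℕ) (Y : Set (Site (F.P K) 0)) (ω : MultiCfg (F.P K) (SU N) (FluctV N)) :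
    0 ≤ zeta0UnifOfRecord F N K j Y ω :=
  inv_nonneg.mpr (Nat.cast_nonneg _)

variable {F N} in
/-- **THE UNIFORM FACTOR RESOLVES UNITY over the region label**: `Σᶠ_Y ζ0 j Y ω = #{Y} · (1 ∕ #{Y}) = 1` (the label type `Set (Site (F.P K) 0)` is finite and
non-empty). [cite: Balaban1988Convergent, (3.16)–(3.20) pp.268–269 (bookkeeping)] -/
theorem finsum_zeta0UnifOfRecord (K : ℕ) (j : ℕ) (ω : MultiCfg (F.P K) (SU N) (FluctV N)) :
    (∑ᶠ Y : Set (Site (F.P K) 0), zeta0UnifOfRecord F N K j Y ω) = 1 := by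
  classical
  haveI : Fintype (Set (Site (F.P K) 0)) := Fintype.ofFinite _
  rw [finsum_eq_sum_of_fintype]
  simp only [zeta0UnifOfRecord, Finset.sum_const, Finset.card_univ, nsmul_eq_mul]
  rw [← Nat.card_eq_fintype_card]
  have hpos : (0 : ℝ) < (Nat.card (Set (Site (F.P K) 0)) : ℝ) := Nat.cast_pos.mpr Nat.card_pos
  exact mul_inv_cancel₀ hpos.ne'

/-- **`Zt` OF RECORD over a supplied form `q`**: `ζ0 :=` the uniform factor, `quad := q` (the successor typing [I]'s `𝒬_j` plugs it here).
[cite: Balaban1988Convergent, p.267, (2.21) p.258, (3.23) p.270] -/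
def ZtOfRecordQ (K : ℕ) (q : ℕ → Set (Site (F.P K) 0) → MultiCfg (F.P K) (SU N) (FluctV N) → ℝ) : TkResidualW F N (FluctV N) K :=
  ⟨zeta0UnifOfRecord F N K, q⟩

/-- 12a's residual law `ζ0 ≥ 0` holds for `ZtOfRecordQ q`, ANY `q`. [cite: Balaban1988Convergent, p.267 (bookkeeping)] -/
theorem ztLaws_ZtOfRecordQ (K : ℕ) (q : ℕ → Set (Site (F.P K) 0) → MultiCfg (F.P K) (SU N) (FluctV N) → ℝ) : (ZtOfRecordQ F N K q).Laws :=
  ⟨fun j Y ω => zeta0UnifOfRecord_nonneg K j Y ω⟩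

/-- 12b's locality law `LocalLaws` (`ζ0 j Y` reads only the scale-`j` variables — here: none) holds for `ZtOfRecordQ q`, ANY `q`.
[cite: Balaban1988Convergent, (3.2)–(3.3) p.265, p.267 (bookkeeping)] -/
theorem ztLocalLaws_ZtOfRecordQ (K : ℕ) (q : ℕ → Set (Site (F.P K) 0) → MultiCfg (F.P K) (SU N) (FluctV N) → ℝ) : (ZtOfRecordQ F N K q).LocalLaws :=
  ⟨by intros; rfl⟩

/-- 12b's named partition of unity (`Stage12Params.ZtUnity`, torus by torus) holds for `ZtOfRecordQ q`, ANY `q`. [cite: Balaban1988Convergent, (3.16)–(3.20) pp.268–269 (bookkeeping)] -/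
theorem finsum_ζ0_ZtOfRecordQ (K : ℕ) (q : ℕ → Set (Site (F.P K) 0) → MultiCfg (F.P K) (SU N) (FluctV N) → ℝ) (j : ℕ)
    (ω : MultiCfg (F.P K) (SU N) (FluctV N)) : (∑ᶠ Y : Set (Site (F.P K) 0), (ZtOfRecordQ F N K q).ζ0 j Y ω) = 1 :=
  finsum_zeta0UnifOfRecord K j ω

/-- **`Zt` OF RECORD**: `ζ0 :=` the uniform factor, `quad :=` the unit-covariance placeholder. [cite: Balaban1988Convergent, p.267, (2.21) p.258, (3.23) p.270] -/
def ZtOfRecord (K : ℕ) : TkResidualW F N (FluctV N) K :=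
  ZtOfRecordQ F N K (quadUnitOfRecord F N K)

/-- **P9 · `ztLaws`**: 12a's residual law holds for `Zt` of record on every torus. [cite: Balaban1988Convergent, p.267, (2.21) p.258] -/
theorem ztLaws_ZtOfRecord (K : ℕ) : (ZtOfRecord F N K).Laws :=
  ztLaws_ZtOfRecordQ F N K _

/-- **P9′ · `ztLocal`**: 12b's locality law holds for `Zt` of record on every torus. [cite: Balaban1988Convergent, (3.2)–(3.3) p.265, p.267] -/
theorem ztLocalLaws_ZtOfRecord (K : ℕ) : (ZtOfRecord F N K).LocalLaws :=
  ztLocalLaws_ZtOfRecordQ F N K _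

/-- **`ZtUnity` torus by torus**: `Σᶠ_Y ζ0 j Y ω = 1` for `Zt` of record. [cite: Balaban1988Convergent, (3.16)–(3.20) pp.268–269] -/
theorem finsum_ζ0_ZtOfRecord (K : ℕ) (j : ℕ) (ω : MultiCfg (F.P K) (SU N) (FluctV N)) :
    (∑ᶠ Y : Set (Site (F.P K) 0), (ZtOfRecord F N K).ζ0 j Y ω) = 1 :=
  finsum_zeta0UnifOfRecord K j ω

/-- The `ζ0` of record is POSITIVE (nowhere the (S3) species). [cite: Balaban1988Convergent, p.267 (bookkeeping)] -/
theorem ZtOfRecord_ζ0_pos (K : ℕ) (j : ℕ) (Y : Set (Site (F.P K) 0)) (ω : MultiCfg (F.P K) (SU N) (FluctV N)) : 0 < (ZtOfRecord F N K).ζ0 j Y ω :=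
  inv_pos.mpr (Nat.cast_pos.mpr Nat.card_pos)

/-- The `quad` of record is the placeholder form (`rfl`), in particular nonnegative (so 11a's `TkWeights.w_le_one` applies at the weights of record).
[cite: Balaban1987RG1, (1.5) p.261 (bookkeeping)] -/
theorem ZtOfRecord_quad_nonneg (K : ℕ) (j : ℕ) (Λ' : Set (Site (F.P K) 0)) (ω : MultiCfg (F.P K) (SU N) (FluctV N)) :
    0 ≤ (ZtOfRecord F N K).quad j Λ' ω :=
  quadUnitOfRecord_nonneg K j Λ' ω

end Zt

/-! ## §3  The residual §2 data `Rz` OF RECORD (the unit recipe) -/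

section Rz

/-- **THE UNIT RECIPE for 11b's residual §2 data**: `U_n(M˙(·)) ≡ 1`, `J_n(M˙(·)) ≡ 0` ((I.1.15)), `U_{p,X} ≡ 1`, `𝐉_{p,X} ≡ 0` on the level-`0` lattice with EMPTY
layer regions ((2.35)), `φ_j ≡ 1` ((2.24)).  NOT print's analytic backgrounds (located (viii)); its junk direction is ENLARGEMENT of the spaces of record.
[cite: Balaban1987RG1, (1.15)–(1.16) p.262; Balaban1988Convergent, (2.35) p.261, (2.24) p.259 (the slots it fills)] -/
def Sect2.Residual.unit (P : Params) (𝔸 : Type*) [NormedRing 𝔸] [NormedAlgebra ℂ 𝔸] [CompleteSpace 𝔸] : Sect2.Residual P 𝔸 where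
  bgI := fun _ _ => ⟨fun _ _ => 1, fun _ _ _ => 0⟩
  bgMS := fun _ _ => ⟨fun _ => 0, fun _ _ => 1, fun _ _ _ => 0, fun _ _ => Sect2.regionOfSet P ∅⟩
  phi := fun _ _ => 1

/-- **11c's RESIDUAL LAWS HOLD FOR THE UNIT RECIPE** (the unit configuration is sent to the unit ∕ zero configurations — four `rfl`s).
[cite: Balaban1987RG1, (1.15) p.262; Balaban1988Convergent, (2.35) p.261] -/
theorem Sect2.Residual.unit_laws (P : Params) (𝔸 : Type*) [NormedRing 𝔸] [NormedAlgebra ℂ 𝔸] [CompleteSpace 𝔸] : (Sect2.Residual.unit P 𝔸).Laws :=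
  ⟨fun _ _ _ => rfl, fun _ _ _ _ => rfl, fun _ _ _ => rfl, fun _ _ _ _ => rfl⟩

variable (F : T4Family) (N : ℕ)

/-- **`Rz` OF RECORD** per torus: the unit recipe in print's matrix algebra `M_N(ℂ)`. [cite: Balaban1987RG1, (1.15) p.262; Balaban1988Convergent, (2.35) p.261, (2.24) p.259] -/
def RzOfRecord (K : ℕ) : Sect2.Residual (F.P K) (MatA N) :=
  Sect2.Residual.unit (F.P K) (MatA N)

/-- **P8 · `rzLaws`**: 11c's laws of the residual §2 data hold for `Rz` of record on every torus. [cite: Balaban1987RG1, (1.15) p.262; Balaban1988Convergent, (2.35) p.261] -/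
theorem rzLaws_RzOfRecord : ∀ K, (RzOfRecord F N K).Laws :=
  fun K => Sect2.Residual.unit_laws (F.P K) (MatA N)

end Rz

/-! ## §4  At `Stage12Params`: the residuals of record and the four proviso fields they discharge -/

section Stage12

variable (F : T4Family) (N : ℕ) [NeZero N]

/-- **«`θ` CARRIES THE RESIDUALS OF RECORD»**: its Stage-9 fluctuation factor is `zeta316OfRecord` at its own numerics and `A₁`, its residual §2 data are
`RzOfRecord`, its residual 𝐓-weight part is `ZtOfRecord` (for a `θ` assembled as a structure literal: `⟨rfl, rfl, rfl⟩`).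
[cite: Balaban1988Convergent, (3.16) p.268, (2.21) p.258, (2.35) p.261 (dictionary; bookkeeping)] -/
structure Stage12Params.HasResidualsOfRecord (θ : Stage12Params F N) : Prop where
  /-- `θ.ζ` is the (3.16) factor of record -/
  zeta_eq : θ.ζ = zeta316OfRecord F N θ.ν θ.τ9.M θ.A₁
  /-- `θ.Rz` is the residual §2 data of record -/
  Rz_eq : θ.Rz = RzOfRecord F N
  /-- `θ.Zt` is the residual 𝐓-weight part of record -/
  Zt_eq : θ.Zt = ZtOfRecord F N

variable {F N}

/-- **P4 at `θ`**: the field `Provisos₁₀.zetaUnity` holds. [cite: Balaban1988Convergent, (3.16) p.268] -/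
theorem Stage12Params.HasResidualsOfRecord.zetaUnity {θ : Stage12Params F N} (h : θ.HasResidualsOfRecord F N) :
    IsZetaUnity F N θ.ν θ.τ9.M θ.ζ := by
  rw [h.zeta_eq]
  exact isZetaUnity_zeta316OfRecord θ.A₁

/-- **P5 at `θ`**: the field `Provisos₁₀.zetaAbs` holds. [cite: Balaban1988Convergent, (3.21) p.269] -/
theorem Stage12Params.HasResidualsOfRecord.zetaAbs {θ : Stage12Params F N} (h : θ.HasResidualsOfRecord F N) :
    IsZetaAbsLeOne F N θ.ν θ.τ9.M θ.ζ := by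
  rw [h.zeta_eq]
  exact isZetaAbsLeOne_zeta316OfRecord θ.A₁

/-- **P8 at `θ`**: the field `Provisos₁₂.rzLaws` holds. [cite: Balaban1987RG1, (1.15) p.262; Balaban1988Convergent, (2.35) p.261] -/
theorem Stage12Params.HasResidualsOfRecord.rzLaws {θ : Stage12Params F N} (h : θ.HasResidualsOfRecord F N) : ∀ K, (θ.Rz K).Laws := by
  rw [h.Rz_eq]
  exact rzLaws_RzOfRecord F N

/-- **P9 at `θ`**: the field `Provisos₁₂.ztLaws` holds. [cite: Balaban1988Convergent, p.267, (2.21) p.258] -/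
theorem Stage12Params.HasResidualsOfRecord.ztLaws {θ : Stage12Params F N} (h : θ.HasResidualsOfRecord F N) : ∀ K, (θ.Zt K).Laws := by
  rw [h.Zt_eq]
  exact ztLaws_ZtOfRecord F N

/-- **P9′ at `θ`**: the field `Provisos₁₂.ztLocal` holds. [cite: Balaban1988Convergent, (3.2)–(3.3) p.265, p.267] -/
theorem Stage12Params.HasResidualsOfRecord.ztLocal {θ : Stage12Params F N} (h : θ.HasResidualsOfRecord F N) : ∀ K, (θ.Zt K).LocalLaws := by
  rw [h.Zt_eq]
  exact ztLocalLaws_ZtOfRecord F N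

/-- **`ZtUnity` at `θ`**: 12b's named partition of unity of the residual factor (a conjunct of the served K0′ text) holds.
[cite: Balaban1988Convergent, (3.16)–(3.20) pp.268–269] -/
theorem Stage12Params.HasResidualsOfRecord.ztUnity {θ : Stage12Params F N} (h : θ.HasResidualsOfRecord F N) : θ.ZtUnity F N := by
  intro K j ω
  rw [h.Zt_eq]
  exact finsum_ζ0_ZtOfRecord F N K j ω

/-- … hence 11a's weight laws for the 𝐓-weights of record of every run (12b's `WtOfRecord₁₂_laws`). [cite: Balaban1988Convergent, (2.21) p.258] -/
theorem Stage12Params.HasResidualsOfRecord.wtLaws {θ : Stage12Params F N} (h : θ.HasResidualsOfRecord F N) (p : B12.RunParams) :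
    (WtOfRecord₁₂ F N θ p).Laws :=
  WtOfRecord₁₂_laws h.ztLaws p

end Stage12

end Literature.MathematicalPhysics.QuantumFieldTheory.Balaban1983to89.Node00

end
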